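import Literature.AnabelianGeometry.EtaleTheta.SettingModelCyclotomicCharacter
import Literature.AnabelianGeometry.EtaleTheta.StandardDataModelNonVacuity
import HarnessLib

/-!
# The level-4 cyclotomic character of `G_{ℚ_p}`: `χ₄ ≡ 1 ⟺ p ≡ 1 (mod 4)` (proof-only, classical)

J.-P. Serre, *A Course in Arithmetic*, Ch. II §3.3, Cor. of Thm. 4: `−1 ∈ (ℚ_p^×)²` iff `p ≡ 1 (mod 4)`
[cite: Serre1973, Ch. II §3.3 Cor. of Thm 4] (the tree's `Padic.exists_sq_eq_neg_one` /
`Padic.mod_four_eq_one_of_sq_eq_neg_one`, abc-iut-w5-d008 `StandardDataModelNonVacuity`); J. Neukirch, *Algebraic Number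
Theory*, Ch. IV §1 (the Galois group acts on `μ_N` through the cyclotomic character; the fixed field of `G_K` is `K`)
[cite: NeukirchANT1999, Ch. IV §1]. S. Mochizuki [EtTh], Publ. RIMS **45** (2009), §1 p. 13: "`K_N := K(ζ_N, q_X^{1/N})`"
[cite: MochizukiEtTh2009, §1 p.13] — at `K = ℚ_p`, `N = 4`: `K_4 ∋ ζ_4` and `ζ_4 ∈ ℚ_p ⟺ p ≡ 1 (4)`.

abc-iut cell, layer L6 / K-L6 instance column, seat abc-iut-L6-d6 (gen 6), row «THM16I-NONINNER-AT-MODELTATE»: the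
CLASSICAL INPUT deciding, by `p mod 4`, the mod-4 Galois arithmetic of the stage-2 Tate model (`modelχq p i 2`) used in
`Discharge/Sec2Cor218iAtModelTateNonInnerModFour.lean`. PROOF-ONLY over abc-iut-w5-d091's `chi` /
`levelChar_chi_eq_of_isPrimitiveRoot` / `apply_eq_pow_levelChar_chi` and abc-iut-w5-d008's `Padic.*`: no definition, no
instance, no `Prop`-valued fact; nothing of [EtTh] is asserted; no side is taken on [IUTchIII] Cor. 3.12.

* `levelChar_four_chi_eq_one_of_mod_four_eq_one` — `p ≡ 1 (mod 4) ⇒ χ₄(σ) = 1` for every `σ ∈ G_{ℚ_p}` (`√−1 ∈ ℚ_p` is a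
  primitive 4th root of unity fixed by `G_{ℚ_p}`);
* `exists_levelChar_four_chi_ne_one_of_mod_four_ne_one` — `p ≢ 1 (mod 4) ⇒ χ₄(τ) ≠ 1` for some `τ` (else a primitive 4th
  root of unity of `ℚ̄_p` is `G_{ℚ_p}`-fixed, hence in `ℚ_p` by the infinite Galois correspondence, and `−1 = ζ_4²` is a
  square in `ℚ_p`);
* `forall_levelChar_four_chi_eq_one_iff` — the equivalence.
-/

noncomputable section

namespace Literature.AnabelianGeometry.EtaleTheta

namespace SettingModel

open Literature.AnabelianGeometry.SemiGraphs Function Topology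

variable (p : ℕ) [Fact p.Prime]

/-! ### `χ₄` and `p mod 4` -/

/-- **`χ₄ ≡ 1` on `G_{ℚ_p}` for `p ≡ 1 (mod 4)`**: `√−1 ∈ ℚ_p` (`Padic.exists_sq_eq_neg_one`) is a primitive 4th root
of unity FIXED by every `σ ∈ G_{ℚ_p}`, and `χ₄(σ)` is read off one primitive 4th root
(`levelChar_chi_eq_of_isPrimitiveRoot`). [cite: Serre1973, Ch. II §3.3 Cor. of Thm 4] -/
theorem levelChar_four_chi_eq_one_of_mod_four_eq_one (hp : p % 4 = 1) (σ : GQp p) :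
    ZHatLevel.levelChar 4 (chi p σ) = 1 := by
  obtain ⟨x, hx⟩ := Padic.exists_sq_eq_neg_one (p := p) hp
  haveI := charZero_padicAlgCl p
  set ξ : PadicAlgCl p := algebraMap ℚ_[p] (PadicAlgCl p) x with hξ
  have hξ2 : ξ ^ 2 = -1 := by rw [hξ, ← map_pow, hx, map_neg, map_one]
  have hξ4 : ξ ^ 4 = 1 := by
    rw [show (4 : ℕ) = 2 * 2 from rfl, pow_mul, hξ2]; norm_num
  have h2ne : (2 : PadicAlgCl p) ≠ 0 := two_ne_zero
  have hne1 : ξ ≠ 1 := by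
    intro h; rw [h, one_pow] at hξ2
    exact h2ne (by linear_combination hξ2)
  have hne2 : ξ ^ 2 ≠ 1 := by
    intro h; rw [h] at hξ2
    exact h2ne (by linear_combination hξ2)
  have hne3 : ξ ^ 3 ≠ 1 := by
    intro h
    have : ξ = 1 := by
      have e : ξ ^ 4 = ξ ^ 3 * ξ := by ring
      rw [hξ4, h, one_mul] at e
      exact e.symm
    exact hne1 this
  have hprim : IsPrimitiveRoot ξ ((4 : ℕ+) : ℕ) := by
    refine IsPrimitiveRoot.mk_of_lt ξ (by norm_num) hξ4 fun l hl0 hl4 => ?_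
    change l < 4 at hl4
    interval_cases l
    · rwa [pow_one]
    · exact hne2
    · exact hne3
  have hσξ : σ ξ = ξ ^ (1 : ℕ) := by rw [pow_one, hξ]; exact σ.commutes x
  rw [levelChar_chi_eq_of_isPrimitiveRoot p σ 4 hprim hσξ, Nat.cast_one]


/-- **`χ₄ ≢ 1` on `G_{ℚ_p}` for `p ≢ 1 (mod 4)`**: otherwise a primitive 4th root of unity of `ℚ̄_p` is fixed by
`G_{ℚ_p}`, hence lies in `ℚ_p` (infinite Galois correspondence), and `−1 = ξ²` is a square in `ℚ_p`
(`Padic.mod_four_eq_one_of_sq_eq_neg_one`). [cite: Serre1973, Ch. II §3.3 Cor. of Thm 4] -/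
theorem exists_levelChar_four_chi_ne_one_of_mod_four_ne_one (hp : p % 4 ≠ 1) :
    ∃ τ : GQp p, ZHatLevel.levelChar 4 (chi p τ) ≠ 1 := by
  by_contra hall
  push Not at hall
  haveI := charZero_padicAlgCl p
  haveI : IsGalois ℚ_[p] (PadicAlgCl p) := {}
  obtain ⟨ξ, hξ⟩ := exists_isPrimitiveRoot_padicAlgCl p 4 (by norm_num)
  have hfix : ∀ σ : GQp p, σ ξ = ξ := fun σ => by
    have h := apply_eq_pow_levelChar_chi p σ 4 (hξ.pow_eq_one)
    rw [hall σ] at h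
    rw [h]
    change ξ ^ (1 : ZMod 4).val = ξ
    rw [show (1 : ZMod 4).val = 1 from rfl, pow_one]
  have hmem : ξ ∈ IntermediateField.fixedField (⊤ : Subgroup (GQp p)) := by
    rw [IntermediateField.mem_fixedField_iff]
    intro σ _
    exact hfix σ
  rw [← IntermediateField.fixingSubgroup_bot, InfiniteGalois.fixedField_fixingSubgroup,
    IntermediateField.mem_bot] at hmem
  obtain ⟨x, hx⟩ := hmem
  -- `ξ² = −1`
  have h4 : ξ ^ 2 * ξ ^ 2 = 1 := by rw [← pow_add]; exact hξ.pow_eq_one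
  have h2 : ξ ^ 2 ≠ 1 := hξ.pow_ne_one_of_pos_of_lt (by norm_num) (by norm_num)
  have hsq : ξ ^ 2 = -1 := by
    rcases mul_self_eq_one_iff.mp h4 with h | h
    · exact absurd h h2
    · exact h
  have hx2 : x ^ 2 = -1 := by
    apply (algebraMap ℚ_[p] (PadicAlgCl p)).injective
    rw [map_pow, hx, hsq, map_neg, map_one]
  exact hp (Padic.mod_four_eq_one_of_sq_eq_neg_one hx2)

/-- `χ₄ ≡ 1` on `G_{ℚ_p}` **iff** `p ≡ 1 (mod 4)`. [cite: Serre1973, Ch. II §3.3 Cor. of Thm 4] -/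
theorem forall_levelChar_four_chi_eq_one_iff :
    (∀ σ : GQp p, ZHatLevel.levelChar 4 (chi p σ) = 1) ↔ p % 4 = 1 := by
  constructor
  · intro h
    by_contra hp
    obtain ⟨τ, hτ⟩ := exists_levelChar_four_chi_ne_one_of_mod_four_ne_one p hp
    exact hτ (h τ)
  · intro hp σ
    exact levelChar_four_chi_eq_one_of_mod_four_eq_one p hp σ


end SettingModel

end Literature.AnabelianGeometry.EtaleTheta

end
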